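import Mathlib
import Literature.MathematicalPhysics.QuantumLattice.FinDimSpectrum

/-!
# Route `NodalDiracTwist` — support `DiskTrivialHolonomy`, part 1: uniform overlap of ground states

Helper file for stmt-HubbardSuperconductivity-1627 (`DiskTrivialHolonomy`). Abstract setting: a
finite index type `ι`, a sector `K ≤ (ι → ℂ)`, a continuous family of matrices `H φ`
(`φ ∈ ℝ²`), and the sector ground states of `FinDimSpectrum`
(`χ ∈ K`, `χ ≠ 0`, `H φ χ = minEnergyOn (H φ) K • χ`, exactly the shape of
`IsGroundStateInSector`). If on the closed disk `D = {|φ - p| ≤ r}` the sector ground state is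
unique up to scalars, then unit ground states at nearby points of `D` have overlap close to `1`,
UNIFORMLY on `D` (`uniform_overlap`). Proof: the graph
`𝒢 = {(φ, χ) : φ ∈ D, χ a unit sector ground state at φ}` is closed — being a ground state is
"eigenvector for its own Rayleigh quotient + Rayleigh-minimal on the unit sphere of `K`"
(`mulVec_eq_minEnergyOn_smul_of_minimal`) — hence compact, and the distance of base points is a
continuous positive function on the compact set `𝒢 × 𝒢 ∩ {|⟨χ, χ'⟩|² ≤ 1 - ε}`.
Kato, *Perturbation Theory for Linear Operators* (1966), II §5.1 (continuity of eigenprojections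
of a simple eigenvalue) is the classical statement; here only the compactness shadow is needed.
No new definitions.
-/

-- the mandated namespace `Summit.<Summit>.<Problem>.Theorems` repeats `HubbardSuperconductivity`
-- (single-problem summit, D-0017), which the `dupNamespace` linter flags on every declaration
set_option linter.dupNamespace false

namespace Summit.HubbardSuperconductivity.HubbardSuperconductivity.Theorems.NodalDiracTwist

open Matrix Complex

variable {ι : Type*} [Fintype ι]

/-! ### Unit vectors for the sesquilinear dot product `star u ⬝ᵥ v` -/

/-- `⟨χ, χ⟩ = Σ_i ‖χ_i‖²` (as a complex number). [folklore] -/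
theorem star_dotProduct_self_eq_sum (χ : ι → ℂ) :
    star χ ⬝ᵥ χ = ((∑ i, ‖χ i‖ ^ 2 : ℝ) : ℂ) := by
  rw [dotProduct, Complex.ofReal_sum]
  refine Finset.sum_congr rfl fun i _ => ?_
  rw [Pi.star_apply, Complex.star_def, Complex.conj_mul', Complex.ofReal_pow]

/-- `re ⟨χ, χ⟩ = Σ_i ‖χ_i‖²`. [folklore] -/
theorem star_dotProduct_self_re (χ : ι → ℂ) : (star χ ⬝ᵥ χ).re = ∑ i, ‖χ i‖ ^ 2 := by
  rw [star_dotProduct_self_eq_sum, Complex.ofReal_re]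

/-- The coordinates of a unit vector are bounded by `1`. [folklore] -/
theorem norm_apply_le_one_of_unit {χ : ι → ℂ} (h : star χ ⬝ᵥ χ = 1) (i : ι) : ‖χ i‖ ≤ 1 := by
  have hsum : ∑ j, ‖χ j‖ ^ 2 = 1 := by
    have h' := star_dotProduct_self_re χ
    rwa [h, Complex.one_re, eq_comm] at h'
  have hi : ‖χ i‖ ^ 2 ≤ 1 :=
    hsum ▸ Finset.single_le_sum (fun j _ => sq_nonneg ‖χ j‖) (Finset.mem_univ i)
  exact (sq_le_one_iff₀ (norm_nonneg _)).1 hi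

/-- A unit vector has sup-norm at most `1`. [folklore] -/
theorem norm_le_one_of_unit {χ : ι → ℂ} (h : star χ ⬝ᵥ χ = 1) : ‖χ‖ ≤ 1 :=
  (pi_norm_le_iff_of_nonneg zero_le_one).2 (norm_apply_le_one_of_unit h)

/-- A unit vector is nonzero. [folklore] -/
theorem ne_zero_of_unit {χ : ι → ℂ} (h : star χ ⬝ᵥ χ = 1) : χ ≠ 0 := by
  rintro rfl
  rw [dotProduct_zero] at h
  exact zero_ne_one h

/-- **AM–GM bound for the sesquilinear dot product**: `|⟨u, v⟩| ≤ (‖u‖² + ‖v‖²)/2`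
(termwise `2|u_i||v_i| ≤ |u_i|² + |v_i|²`). [folklore] -/
theorem norm_star_dotProduct_le (u v : ι → ℂ) :
    ‖star u ⬝ᵥ v‖ ≤ ((star u ⬝ᵥ u).re + (star v ⬝ᵥ v).re) / 2 := by
  rw [star_dotProduct_self_re, star_dotProduct_self_re, dotProduct]
  refine (norm_sum_le _ _).trans ?_
  have key : ∀ i, ‖(star u) i * v i‖ ≤ (‖u i‖ ^ 2 + ‖v i‖ ^ 2) / 2 := fun i => by
    rw [norm_mul, Pi.star_apply, norm_star]
    nlinarith [sq_nonneg (‖u i‖ - ‖v i‖)]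
  calc ∑ i, ‖(star u) i * v i‖ ≤ ∑ i, (‖u i‖ ^ 2 + ‖v i‖ ^ 2) / 2 :=
        Finset.sum_le_sum fun i _ => key i
    _ = ((∑ i, ‖u i‖ ^ 2) + ∑ i, ‖v i‖ ^ 2) / 2 := by
        rw [← Finset.sum_div, Finset.sum_add_distrib]

/-- Overlaps of unit vectors are bounded by `1`. [folklore] -/
theorem norm_star_dotProduct_le_one {u v : ι → ℂ} (hu : star u ⬝ᵥ u = 1) (hv : star v ⬝ᵥ v = 1) :
    ‖star u ⬝ᵥ v‖ ≤ 1 := by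
  have h := norm_star_dotProduct_le u v
  rw [hu, hv, Complex.one_re] at h
  linarith

/-- Scaling a unit vector by `z` multiplies `⟨·, ·⟩` by `‖z‖²`. [folklore] -/
theorem star_smul_dotProduct_smul (z : ℂ) (u v : ι → ℂ) :
    star (z • u) ⬝ᵥ (z • v) = ((‖z‖ ^ 2 : ℝ) : ℂ) * (star u ⬝ᵥ v) := by
  rw [star_smul, smul_dotProduct, dotProduct_smul, smul_smul, smul_eq_mul, Complex.star_def,
    Complex.conj_mul', Complex.ofReal_pow]

/-- If `χ` and `z • χ` are both unit vectors then `‖z‖ = 1`. [folklore] -/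
theorem norm_eq_one_of_unit_smul {z : ℂ} {χ : ι → ℂ} (h : star χ ⬝ᵥ χ = 1)
    (hz : star (z • χ) ⬝ᵥ (z • χ) = 1) : ‖z‖ = 1 := by
  rw [star_smul_dotProduct_smul, h, mul_one, ← Complex.ofReal_one, Complex.ofReal_inj] at hz
  have h0 : 0 ≤ ‖z‖ := norm_nonneg z
  nlinarith [hz]

/-! ### Compactness of the disk and of the unit sphere -/

/-- The closed disk `{(φ₀ - p₀)² + (φ₁ - p₁)² ≤ r²}` of `ℝ²` is compact. [folklore] -/
theorem isCompact_disk (p : Fin 2 → ℝ) {r : ℝ} (hr : 0 ≤ r) :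
    IsCompact {φ : Fin 2 → ℝ | (φ 0 - p 0) ^ 2 + (φ 1 - p 1) ^ 2 ≤ r ^ 2} := by
  refine Metric.isCompact_of_isClosed_isBounded (isClosed_le (by fun_prop) continuous_const) ?_
  refine (Metric.isBounded_closedBall (x := p) (r := r)).subset fun φ hφ => ?_
  have hφ' : (φ 0 - p 0) ^ 2 + (φ 1 - p 1) ^ 2 ≤ r ^ 2 := hφ
  rw [Metric.mem_closedBall, dist_pi_le_iff hr]
  intro ν
  rw [Real.dist_eq]
  have h0 : (φ 0 - p 0) ^ 2 ≤ r ^ 2 := by nlinarith [sq_nonneg (φ 1 - p 1)]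
  have h1 : (φ 1 - p 1) ^ 2 ≤ r ^ 2 := by nlinarith [sq_nonneg (φ 0 - p 0)]
  fin_cases ν
  · exact abs_le_of_sq_le_sq h0 hr
  · exact abs_le_of_sq_le_sq h1 hr

/-- The unit sphere `{⟨χ, χ⟩ = 1}` of `ι → ℂ` is compact. [folklore] -/
theorem isCompact_unitSphere : IsCompact {χ : ι → ℂ | star χ ⬝ᵥ χ = 1} := by
  refine Metric.isCompact_of_isClosed_isBounded
    (isClosed_eq (continuous_star.dotProduct continuous_id) continuous_const) ?_
  refine (Metric.isBounded_closedBall (x := (0 : ι → ℂ)) (r := 1)).subset fun χ hχ => ?_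
  rw [Metric.mem_closedBall, dist_zero_right]
  exact norm_le_one_of_unit hχ

/-! ### Sector ground states: the closed characterisation -/

section Sector

variable (K : Submodule ℂ (ι → ℂ))

/-- A unit sector ground state (eigenvector of `A` in `K` for the sector energy
`minEnergyOn A K`) is an eigenvector for its own Rayleigh quotient and is Rayleigh-minimal among
the unit vectors of `K` (given the variational lower bound `hlb`, which holds for Hermitian `A`
preserving `K`). Tasaki (2020) §2.1–2.2. [folklore] -/
theorem minimal_of_mulVec_eq_minEnergyOn_smul {A : Matrix ι ι ℂ}
    (hlb : ∀ v ∈ K, star v ⬝ᵥ v = 1 → A.minEnergyOn K ≤ (star v ⬝ᵥ A *ᵥ v).re)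
    {χ : ι → ℂ} (hχ : A *ᵥ χ = ((A.minEnergyOn K : ℝ) : ℂ) • χ) (h1 : star χ ⬝ᵥ χ = 1) :
    A *ᵥ χ = (((star χ ⬝ᵥ A *ᵥ χ).re : ℝ) : ℂ) • χ ∧
      ∀ ξ ∈ K, star ξ ⬝ᵥ ξ = 1 → (star χ ⬝ᵥ A *ᵥ χ).re ≤ (star ξ ⬝ᵥ A *ᵥ ξ).re := by
  have hre : (star χ ⬝ᵥ A *ᵥ χ).re = A.minEnergyOn K := by
    rw [hχ, dotProduct_smul, h1, smul_eq_mul, mul_one, Complex.ofReal_re]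
  rw [hre]
  exact ⟨hχ, hlb⟩

/-- Conversely, a unit vector of `K` which is an eigenvector for its own Rayleigh quotient and is
Rayleigh-minimal among the unit vectors of `K` is a sector ground state: its Rayleigh quotient IS
the sector energy (the infimum is attained, `IsLeast.csInf_eq`). Tasaki (2020) §2.1. [folklore] -/
theorem mulVec_eq_minEnergyOn_smul_of_minimal {A : Matrix ι ι ℂ} {χ : ι → ℂ} (hχK : χ ∈ K)
    (h1 : star χ ⬝ᵥ χ = 1) (hχ : A *ᵥ χ = (((star χ ⬝ᵥ A *ᵥ χ).re : ℝ) : ℂ) • χ)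
    (hmin : ∀ ξ ∈ K, star ξ ⬝ᵥ ξ = 1 → (star χ ⬝ᵥ A *ᵥ χ).re ≤ (star ξ ⬝ᵥ A *ᵥ ξ).re) :
    A *ᵥ χ = ((A.minEnergyOn K : ℝ) : ℂ) • χ := by
  have hE : A.minEnergyOn K = (star χ ⬝ᵥ A *ᵥ χ).re := by
    rw [Matrix.minEnergyOn]
    apply IsLeast.csInf_eq
    refine ⟨⟨χ, hχK, h1, rfl⟩, ?_⟩
    rintro E ⟨ξ, hξ, hξ1, rfl⟩
    exact hmin ξ hξ hξ1
  rw [hE]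
  exact hχ

variable (H : (Fin 2 → ℝ) → Matrix ι ι ℂ)

/-- The graph `{(φ, χ) : φ ∈ D, χ ∈ K unit, eigenvector for its Rayleigh quotient, Rayleigh-minimal}`
is closed, for `H` continuous and `D` closed. [folklore] -/
theorem isClosed_groundStateGraph (hH : Continuous H) {D : Set (Fin 2 → ℝ)} (hD : IsClosed D) :
    IsClosed {x : (Fin 2 → ℝ) × (ι → ℂ) | x.1 ∈ D ∧ x.2 ∈ K ∧ star x.2 ⬝ᵥ x.2 = 1 ∧
      H x.1 *ᵥ x.2 = (((star x.2 ⬝ᵥ H x.1 *ᵥ x.2).re : ℝ) : ℂ) • x.2 ∧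
      ∀ ξ ∈ K, star ξ ⬝ᵥ ξ = 1 →
        (star x.2 ⬝ᵥ H x.1 *ᵥ x.2).re ≤ (star ξ ⬝ᵥ H x.1 *ᵥ ξ).re} := by
  have hc1 : Continuous fun x : (Fin 2 → ℝ) × (ι → ℂ) => H x.1 *ᵥ x.2 :=
    (hH.comp continuous_fst).matrix_mulVec continuous_snd
  have hc2 : Continuous fun x : (Fin 2 → ℝ) × (ι → ℂ) => (star x.2 ⬝ᵥ H x.1 *ᵥ x.2).re :=
    Complex.continuous_re.comp (continuous_snd.star.dotProduct hc1)
  have hc3 : ∀ ξ : ι → ℂ,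
      Continuous fun x : (Fin 2 → ℝ) × (ι → ℂ) => (star ξ ⬝ᵥ H x.1 *ᵥ ξ).re := fun ξ =>
    Complex.continuous_re.comp
      (continuous_const.dotProduct ((hH.comp continuous_fst).matrix_mulVec continuous_const))
  have hK : IsClosed (K : Set (ι → ℂ)) := K.closed_of_finiteDimensional
  simp only [Set.setOf_and, Set.setOf_forall]
  refine (hD.preimage continuous_fst).inter ((hK.preimage continuous_snd).inter
    ((isClosed_eq (continuous_snd.star.dotProduct continuous_snd) continuous_const).inter
    ((isClosed_eq hc1 ?_).inter
      (isClosed_iInter fun ξ => isClosed_iInter fun _ => isClosed_iInter fun _ =>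
        isClosed_le hc2 (hc3 ξ)))))
  exact (Complex.continuous_ofReal.comp hc2).smul continuous_snd

/-- … and it is compact when `D` is the closed disk. [folklore] -/
theorem isCompact_groundStateGraph (hH : Continuous H) (p : Fin 2 → ℝ) {r : ℝ} (hr : 0 ≤ r) :
    IsCompact {x : (Fin 2 → ℝ) × (ι → ℂ) | (x.1 0 - p 0) ^ 2 + (x.1 1 - p 1) ^ 2 ≤ r ^ 2 ∧
      x.2 ∈ K ∧ star x.2 ⬝ᵥ x.2 = 1 ∧
      H x.1 *ᵥ x.2 = (((star x.2 ⬝ᵥ H x.1 *ᵥ x.2).re : ℝ) : ℂ) • x.2 ∧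
      ∀ ξ ∈ K, star ξ ⬝ᵥ ξ = 1 →
        (star x.2 ⬝ᵥ H x.1 *ᵥ x.2).re ≤ (star ξ ⬝ᵥ H x.1 *ᵥ ξ).re} :=
  ((isCompact_disk p hr).prod isCompact_unitSphere).of_isClosed_subset
    (isClosed_groundStateGraph K H hH (isCompact_disk p hr).isClosed)
    fun _ hx => ⟨hx.1, hx.2.2.1⟩

/-- **Uniform overlap of sector ground states.** Let `H` be a continuous family of matrices whose
sector energy on `K` obeys the variational lower bound, and suppose the sector ground state is
unique up to scalars at every point of the closed disk `D`. Then for every `ε > 0` there is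
`δ > 0` such that unit sector ground states at points of `D` at (sup-)distance `< δ` have
`|⟨χ, χ'⟩|² > 1 - ε`. (Compactness of the ground-state graph; the distance of base points is
positive on the compact set where the overlap is `≤ 1 - ε`.) Kato (1966) II §5.1 is the
analytic prototype. [folklore] -/
theorem uniform_overlap (hH : Continuous H) (p : Fin 2 → ℝ) {r : ℝ} (hr : 0 ≤ r)
    (hlb : ∀ φ, ∀ v ∈ K, star v ⬝ᵥ v = 1 → (H φ).minEnergyOn K ≤ (star v ⬝ᵥ H φ *ᵥ v).re)
    (huniq : ∀ φ : Fin 2 → ℝ, (φ 0 - p 0) ^ 2 + (φ 1 - p 1) ^ 2 ≤ r ^ 2 → ∀ χ₁ χ₂ : ι → ℂ,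
      (χ₁ ∈ K ∧ χ₁ ≠ 0 ∧ H φ *ᵥ χ₁ = (((H φ).minEnergyOn K : ℝ) : ℂ) • χ₁) →
      (χ₂ ∈ K ∧ χ₂ ≠ 0 ∧ H φ *ᵥ χ₂ = (((H φ).minEnergyOn K : ℝ) : ℂ) • χ₂) →
      ∃ z : ℂ, χ₂ = z • χ₁)
    {ε : ℝ} (hε : 0 < ε) :
    ∃ δ : ℝ, 0 < δ ∧ ∀ φ φ' : Fin 2 → ℝ,
      (φ 0 - p 0) ^ 2 + (φ 1 - p 1) ^ 2 ≤ r ^ 2 → (φ' 0 - p 0) ^ 2 + (φ' 1 - p 1) ^ 2 ≤ r ^ 2 →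
      dist φ φ' < δ → ∀ χ χ' : ι → ℂ,
      (χ ∈ K ∧ χ ≠ 0 ∧ H φ *ᵥ χ = (((H φ).minEnergyOn K : ℝ) : ℂ) • χ) → star χ ⬝ᵥ χ = 1 →
      (χ' ∈ K ∧ χ' ≠ 0 ∧ H φ' *ᵥ χ' = (((H φ').minEnergyOn K : ℝ) : ℂ) • χ') →
      star χ' ⬝ᵥ χ' = 1 →
      1 - ε < ‖star χ ⬝ᵥ χ'‖ ^ 2 := by
  classical
  -- the compact ground-state graph
  set G := {x : (Fin 2 → ℝ) × (ι → ℂ) | (x.1 0 - p 0) ^ 2 + (x.1 1 - p 1) ^ 2 ≤ r ^ 2 ∧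
      x.2 ∈ K ∧ star x.2 ⬝ᵥ x.2 = 1 ∧
      H x.1 *ᵥ x.2 = (((star x.2 ⬝ᵥ H x.1 *ᵥ x.2).re : ℝ) : ℂ) • x.2 ∧
      ∀ ξ ∈ K, star ξ ⬝ᵥ ξ = 1 →
        (star x.2 ⬝ᵥ H x.1 *ᵥ x.2).re ≤ (star ξ ⬝ᵥ H x.1 *ᵥ ξ).re} with hG
  have hGc : IsCompact G := isCompact_groundStateGraph K H hH p hr
  have hmemG : ∀ (φ : Fin 2 → ℝ) (χ : ι → ℂ), (φ 0 - p 0) ^ 2 + (φ 1 - p 1) ^ 2 ≤ r ^ 2 →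
      (χ ∈ K ∧ χ ≠ 0 ∧ H φ *ᵥ χ = (((H φ).minEnergyOn K : ℝ) : ℂ) • χ) → star χ ⬝ᵥ χ = 1 →
      (φ, χ) ∈ G := fun φ χ hφ hχ h1 =>
    ⟨hφ, hχ.1, h1, minimal_of_mulVec_eq_minEnergyOn_smul K (hlb φ) hχ.2.2 h1⟩
  have hGS : ∀ x ∈ G,
      x.2 ∈ K ∧ x.2 ≠ 0 ∧ H x.1 *ᵥ x.2 = (((H x.1).minEnergyOn K : ℝ) : ℂ) • x.2 :=
    fun x hx => ⟨hx.2.1, ne_zero_of_unit hx.2.2.1,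
      mulVec_eq_minEnergyOn_smul_of_minimal K hx.2.1 hx.2.2.1 hx.2.2.2.1 hx.2.2.2.2⟩
  -- the overlap and the base-point distance on `G × G`
  set f : ((Fin 2 → ℝ) × (ι → ℂ)) × ((Fin 2 → ℝ) × (ι → ℂ)) → ℝ :=
    fun z => ‖star z.1.2 ⬝ᵥ z.2.2‖ ^ 2 with hf
  have hfc : Continuous f := by
    simp only [hf]
    fun_prop
  set g : ((Fin 2 → ℝ) × (ι → ℂ)) × ((Fin 2 → ℝ) × (ι → ℂ)) → ℝ :=
    fun z => dist z.1.1 z.2.1 with hg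
  have hgc : Continuous g := by
    simp only [hg]
    fun_prop
  set B := (G ×ˢ G) ∩ {z | f z ≤ 1 - ε} with hB
  have hBc : IsCompact B := (hGc.prod hGc).inter_right (isClosed_le hfc continuous_const)
  -- on `B` the base points differ (uniqueness of the ground state at a common base point)
  have hpos : ∀ z ∈ B, 0 < g z := by
    rintro ⟨⟨φ, χ⟩, ⟨φ', χ'⟩⟩ ⟨⟨hx, hy⟩, hfz⟩
    change 0 < dist φ φ'
    refine dist_pos.2 fun hφφ' => ?_
    subst hφφ'
    obtain ⟨z, hz⟩ := huniq φ hx.1 χ χ' (hGS _ hx) (hGS _ hy)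
    have h1 : star χ ⬝ᵥ χ = 1 := hx.2.2.1
    have h1' : star χ' ⬝ᵥ χ' = 1 := hy.2.2.1
    rw [hz] at h1'
    have hz1 : ‖z‖ = 1 := norm_eq_one_of_unit_smul h1 h1'
    have hfz1 : f ((φ, χ), (φ, χ')) = 1 := by
      change ‖star χ ⬝ᵥ χ'‖ ^ 2 = 1
      rw [hz, dotProduct_smul, h1, smul_eq_mul, mul_one, hz1, one_pow]
    have hfz' : f ((φ, χ), (φ, χ')) ≤ 1 - ε := hfz
    linarith
  by_cases hBne : B.Nonempty
  · obtain ⟨z₀, hz₀, hmin⟩ := hBc.exists_isMinOn hBne hgc.continuousOn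
    refine ⟨g z₀, hpos z₀ hz₀, ?_⟩
    intro φ φ' hφ hφ' hd χ χ' hχ h1 hχ' h1'
    by_contra hlt
    have hzB : ((φ, χ), (φ', χ')) ∈ B :=
      ⟨⟨hmemG φ χ hφ hχ h1, hmemG φ' χ' hφ' hχ' h1'⟩, not_lt.1 hlt⟩
    have hle := (isMinOn_iff.1 hmin) _ hzB
    exact absurd hle (not_le.2 hd)
  · refine ⟨1, one_pos, ?_⟩
    intro φ φ' hφ hφ' _ χ χ' hχ h1 hχ' h1'
    by_contra hlt
    exact hBne ⟨((φ, χ), (φ', χ')), ⟨hmemG φ χ hφ hχ h1, hmemG φ' χ' hφ' hχ' h1'⟩, not_lt.1 hlt⟩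

end Sector

end Summit.HubbardSuperconductivity.HubbardSuperconductivity.Theorems.NodalDiracTwist
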